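import Summits.NavierStokesRegularity.NavierStokesRegularity.Theorems.EfficiencyFloorRigidExitSaturationExit
import HarnessLib

/-!
# Route `EfficiencyFloor`, rung `LerayFloorGap` (stmt-25164) and its children 25482 / 25483 / 25512 / 25513:
# the ATTAINMENT DICHOTOMY for the sharp Lu–Doering constant, BY NAME

Helper file (`--supports stmt-NavierStokesRegularity-25482`). All four open nodes under `LerayFloorGap` speak about NORMALISED
MAXIMISERS of the sharp one-sided Lu–Doering constant `c⋆` (admissible fields `m` with `Z(m) > 0`,
`S(m) = c⋆·Z^{3/4}·Pal^{3/4}`, `Pal(m) = (81c⋆⁴/(256ν⁴))·Z(m)³`). Whether ANY such field exists — attainment of `c⋆` on `ℝ³`,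
a concentration-compactness question flagged in the why-might-fail of stmt-25482 — splits the rung cleanly, and this file
records the split against the route decls VERBATIM:

* `attained_of_nearSaturationNearMaximiser` — `NearSaturationNearMaximiser` (25482) ⟹ for the sharp constant there are
  `ν > 0` and a normalised maximiser `m`. (Minimality of `c⋆` gives, for every `δ′ > 0`, an admissible `w` with efficiency
  `> (1 − δ′)c⋆`; choosing the viscosity `ν = (81c⋆⁴Z(w)³/(256·Pal(w)))^{1/4}` puts `w` at the Young-optimal amplitude, where
  the cubic law is `(1 − 4δ′)`-saturated (`RigidExit.saturated_of_normalised`, p824803); the item then produces `m`.)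
  Hence `not_nearSaturationNearMaximiser_of_not_attained`: NON-attainment REFUTES 25482.
* `nearMaximiserBoundedAmplification_of_not_attained`, `maximiserSetRigidity_of_not_attained`, `rigidExit_of_not_attained` —
  NON-attainment makes `NearMaximiserBoundedAmplification` (25483), `MaximiserSetRigidity` (25512) and `RigidExit` (25513)
  TRUE VACUOUSLY (empty maximiser list, no slice is ever close to a maximiser).

READING. The `LerayFloorGap` glue (25485) consumes 25482 ∧ 25483; by this file the two are jointly NON-VACUOUS only if `c⋆`
is attained, and under non-attainment the glue's route to `LerayFloorGap` is dead (25482 false) while 25483/25512/25513 would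
close without content. So the FIRST deciding question of the whole rung is attainment of the scale-invariant functional
`S/(Z^{3/4}Pal^{3/4})` on `ℝ³` (vanishing is excluded by the landed `EfficiencyConcentration` stmt-23111; dichotomy is the
open part), and any by-name closure of 25483/25512/25513 must be read together with an attainment certificate. HONEST FRAMING:
pure logic and one amplitude computation over OPEN statements; nothing here decides attainment; 25482, 25483, 25512, 25513,
`LerayFloorGap`, `ProductionEfficiencyDecay` and Navier–Stokes regularity stay OPEN; no summit statement is proved. [folklore]
-/

-- the problem directory repeats the summit name (`NavierStokesRegularity/NavierStokesRegularity`)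
set_option linter.dupNamespace false

noncomputable section

namespace Summit.NavierStokesRegularity.NavierStokesRegularity.Theorems

namespace LerayFloorGap

namespace Attainment

open Set MeasureTheory Filter Topology Function
open scoped InnerProductSpace ENNReal
open Literature.Analysis.FluidPDE

/-! ## Non-attainment makes the bet nodes vacuous -/

/-- **Non-attainment ⟹ `NearMaximiserBoundedAmplification` (vacuously).** If for the sharp constant no normalised maximiser
exists at any viscosity, the route decl stmt-25483 holds with `A = 1`, `ε = 1`: its maximiser hypothesis is never met.
[folklore] -/
theorem nearMaximiserBoundedAmplification_of_not_attained
    (h : ∀ c : ℝ, (0 < c ∧ (∀ v : EuclideanSpace ℝ (Fin 3) → EuclideanSpace ℝ (Fin 3), (ContDiff ℝ (⊤ : ℕ∞) v ∧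
      Literature.Analysis.FluidPDE.VectorCalculus.IsDivFree v ∧ (∫⁻ x, ‖iteratedFDeriv ℝ 0 v x‖ₑ ^ 2 < ⊤) ∧ (∫⁻ x,
      ‖iteratedFDeriv ℝ 1 v x‖ₑ ^ 2 < ⊤) ∧ (∫⁻ x, ‖iteratedFDeriv ℝ 2 v x‖ₑ ^ 2 < ⊤)) → (∫ x,
      ⟪Literature.Analysis.FluidPDE.curl v x, fderiv ℝ v x (Literature.Analysis.FluidPDE.curl v x)⟫_ℝ) ≤ c * (∫ x,
      ‖Literature.Analysis.FluidPDE.curl v x‖ ^ 2) ^ (3 / 4 : ℝ) * (∫ x,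
      Literature.Analysis.FluidPDE.frobeniusNormSq (fderiv ℝ (Literature.Analysis.FluidPDE.curl v) x)) ^ (3 / 4 :
      ℝ)) ∧ ∀ c' : ℝ, (∀ w : EuclideanSpace ℝ (Fin 3) → EuclideanSpace ℝ (Fin 3), (ContDiff ℝ (⊤ : ℕ∞) w ∧
      Literature.Analysis.FluidPDE.VectorCalculus.IsDivFree w ∧ (∫⁻ x, ‖iteratedFDeriv ℝ 0 w x‖ₑ ^ 2 < ⊤) ∧ (∫⁻ x,
      ‖iteratedFDeriv ℝ 1 w x‖ₑ ^ 2 < ⊤) ∧ (∫⁻ x, ‖iteratedFDeriv ℝ 2 w x‖ₑ ^ 2 < ⊤)) → (∫ x,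
      ⟪Literature.Analysis.FluidPDE.curl w x, fderiv ℝ w x (Literature.Analysis.FluidPDE.curl w x)⟫_ℝ) ≤ c' * (∫
      x, ‖Literature.Analysis.FluidPDE.curl w x‖ ^ 2) ^ (3 / 4 : ℝ) * (∫ x,
      Literature.Analysis.FluidPDE.frobeniusNormSq (fderiv ℝ (Literature.Analysis.FluidPDE.curl w) x)) ^ (3 / 4 :
      ℝ)) → c ≤ c') → ∀ ν : ℝ, 0 < ν → ∀ m : EuclideanSpace ℝ (Fin 3) → EuclideanSpace ℝ (Fin 3), ¬ ((ContDiff ℝ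
      (⊤ : ℕ∞) m ∧ Literature.Analysis.FluidPDE.VectorCalculus.IsDivFree m ∧ (∫⁻ x, ‖iteratedFDeriv ℝ 0 m x‖ₑ ^ 2
      < ⊤) ∧ (∫⁻ x, ‖iteratedFDeriv ℝ 1 m x‖ₑ ^ 2 < ⊤) ∧ (∫⁻ x, ‖iteratedFDeriv ℝ 2 m x‖ₑ ^ 2 < ⊤)) ∧ 0 < (∫ x,
      ‖Literature.Analysis.FluidPDE.curl m x‖ ^ 2) ∧ (∫ x, ⟪Literature.Analysis.FluidPDE.curl m x, fderiv ℝ m x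
      (Literature.Analysis.FluidPDE.curl m x)⟫_ℝ) = c * (∫ x, ‖Literature.Analysis.FluidPDE.curl m x‖ ^ 2) ^ (3 /
      4 : ℝ) * (∫ x, Literature.Analysis.FluidPDE.frobeniusNormSq (fderiv ℝ (Literature.Analysis.FluidPDE.curl m)
      x)) ^ (3 / 4 : ℝ) ∧ (∫ x, Literature.Analysis.FluidPDE.frobeniusNormSq (fderiv ℝ
      (Literature.Analysis.FluidPDE.curl m) x)) = 81 * c ^ 4 / (256 * ν ^ 4) * (∫ x,
      ‖Literature.Analysis.FluidPDE.curl m x‖ ^ 2) ^ 3)) :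
    Summit.NavierStokesRegularity.NavierStokesRegularity.Theses.EfficiencyFloor.NearMaximiserBoundedAmplification := by
  intro c hsharp
  refine ⟨1, 1, le_rfl, one_pos, ?_⟩
  intro ν T hν _hT u p _hmax _hLH _hdec s _hs m hm
  exact absurd hm (h c hsharp ν hν m)

/-- **Non-attainment ⟹ `MaximiserSetRigidity` (vacuously).** With no normalised maximiser, the empty list (`k = 0`)
classifies the maximiser set and clause (b) has no instance. [folklore] -/
theorem maximiserSetRigidity_of_not_attained
    (h : ∀ c : ℝ, (0 < c ∧ (∀ v : EuclideanSpace ℝ (Fin 3) → EuclideanSpace ℝ (Fin 3), (ContDiff ℝ (⊤ : ℕ∞) v ∧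
      Literature.Analysis.FluidPDE.VectorCalculus.IsDivFree v ∧ (∫⁻ x, ‖iteratedFDeriv ℝ 0 v x‖ₑ ^ 2 < ⊤) ∧ (∫⁻ x,
      ‖iteratedFDeriv ℝ 1 v x‖ₑ ^ 2 < ⊤) ∧ (∫⁻ x, ‖iteratedFDeriv ℝ 2 v x‖ₑ ^ 2 < ⊤)) → (∫ x,
      ⟪Literature.Analysis.FluidPDE.curl v x, fderiv ℝ v x (Literature.Analysis.FluidPDE.curl v x)⟫_ℝ) ≤ c * (∫ x,
      ‖Literature.Analysis.FluidPDE.curl v x‖ ^ 2) ^ (3 / 4 : ℝ) * (∫ x,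
      Literature.Analysis.FluidPDE.frobeniusNormSq (fderiv ℝ (Literature.Analysis.FluidPDE.curl v) x)) ^ (3 / 4 :
      ℝ)) ∧ ∀ c' : ℝ, (∀ w : EuclideanSpace ℝ (Fin 3) → EuclideanSpace ℝ (Fin 3), (ContDiff ℝ (⊤ : ℕ∞) w ∧
      Literature.Analysis.FluidPDE.VectorCalculus.IsDivFree w ∧ (∫⁻ x, ‖iteratedFDeriv ℝ 0 w x‖ₑ ^ 2 < ⊤) ∧ (∫⁻ x,
      ‖iteratedFDeriv ℝ 1 w x‖ₑ ^ 2 < ⊤) ∧ (∫⁻ x, ‖iteratedFDeriv ℝ 2 w x‖ₑ ^ 2 < ⊤)) → (∫ x,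
      ⟪Literature.Analysis.FluidPDE.curl w x, fderiv ℝ w x (Literature.Analysis.FluidPDE.curl w x)⟫_ℝ) ≤ c' * (∫
      x, ‖Literature.Analysis.FluidPDE.curl w x‖ ^ 2) ^ (3 / 4 : ℝ) * (∫ x,
      Literature.Analysis.FluidPDE.frobeniusNormSq (fderiv ℝ (Literature.Analysis.FluidPDE.curl w) x)) ^ (3 / 4 :
      ℝ)) → c ≤ c') → ∀ ν : ℝ, 0 < ν → ∀ m : EuclideanSpace ℝ (Fin 3) → EuclideanSpace ℝ (Fin 3), ¬ ((ContDiff ℝ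
      (⊤ : ℕ∞) m ∧ Literature.Analysis.FluidPDE.VectorCalculus.IsDivFree m ∧ (∫⁻ x, ‖iteratedFDeriv ℝ 0 m x‖ₑ ^ 2
      < ⊤) ∧ (∫⁻ x, ‖iteratedFDeriv ℝ 1 m x‖ₑ ^ 2 < ⊤) ∧ (∫⁻ x, ‖iteratedFDeriv ℝ 2 m x‖ₑ ^ 2 < ⊤)) ∧ 0 < (∫ x,
      ‖Literature.Analysis.FluidPDE.curl m x‖ ^ 2) ∧ (∫ x, ⟪Literature.Analysis.FluidPDE.curl m x, fderiv ℝ m x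
      (Literature.Analysis.FluidPDE.curl m x)⟫_ℝ) = c * (∫ x, ‖Literature.Analysis.FluidPDE.curl m x‖ ^ 2) ^ (3 /
      4 : ℝ) * (∫ x, Literature.Analysis.FluidPDE.frobeniusNormSq (fderiv ℝ (Literature.Analysis.FluidPDE.curl m)
      x)) ^ (3 / 4 : ℝ) ∧ (∫ x, Literature.Analysis.FluidPDE.frobeniusNormSq (fderiv ℝ
      (Literature.Analysis.FluidPDE.curl m) x)) = 81 * c ^ 4 / (256 * ν ^ 4) * (∫ x,
      ‖Literature.Analysis.FluidPDE.curl m x‖ ^ 2) ^ 3)) :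
    Summit.NavierStokesRegularity.NavierStokesRegularity.Theses.EfficiencyFloor.MaximiserSetRigidity := by
  intro c ν hsharp hν
  refine ⟨0, fun i => i.elim0, fun i => i.elim0, fun m hm => ?_⟩
  exact absurd hm (h c hsharp ν hν m)

/-- **Non-attainment ⟹ `RigidExit` (vacuously, through its conclusion).** [folklore] -/
theorem rigidExit_of_not_attained
    (h : ∀ c : ℝ, (0 < c ∧ (∀ v : EuclideanSpace ℝ (Fin 3) → EuclideanSpace ℝ (Fin 3), (ContDiff ℝ (⊤ : ℕ∞) v ∧
      Literature.Analysis.FluidPDE.VectorCalculus.IsDivFree v ∧ (∫⁻ x, ‖iteratedFDeriv ℝ 0 v x‖ₑ ^ 2 < ⊤) ∧ (∫⁻ x,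
      ‖iteratedFDeriv ℝ 1 v x‖ₑ ^ 2 < ⊤) ∧ (∫⁻ x, ‖iteratedFDeriv ℝ 2 v x‖ₑ ^ 2 < ⊤)) → (∫ x,
      ⟪Literature.Analysis.FluidPDE.curl v x, fderiv ℝ v x (Literature.Analysis.FluidPDE.curl v x)⟫_ℝ) ≤ c * (∫ x,
      ‖Literature.Analysis.FluidPDE.curl v x‖ ^ 2) ^ (3 / 4 : ℝ) * (∫ x,
      Literature.Analysis.FluidPDE.frobeniusNormSq (fderiv ℝ (Literature.Analysis.FluidPDE.curl v) x)) ^ (3 / 4 :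
      ℝ)) ∧ ∀ c' : ℝ, (∀ w : EuclideanSpace ℝ (Fin 3) → EuclideanSpace ℝ (Fin 3), (ContDiff ℝ (⊤ : ℕ∞) w ∧
      Literature.Analysis.FluidPDE.VectorCalculus.IsDivFree w ∧ (∫⁻ x, ‖iteratedFDeriv ℝ 0 w x‖ₑ ^ 2 < ⊤) ∧ (∫⁻ x,
      ‖iteratedFDeriv ℝ 1 w x‖ₑ ^ 2 < ⊤) ∧ (∫⁻ x, ‖iteratedFDeriv ℝ 2 w x‖ₑ ^ 2 < ⊤)) → (∫ x,
      ⟪Literature.Analysis.FluidPDE.curl w x, fderiv ℝ w x (Literature.Analysis.FluidPDE.curl w x)⟫_ℝ) ≤ c' * (∫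
      x, ‖Literature.Analysis.FluidPDE.curl w x‖ ^ 2) ^ (3 / 4 : ℝ) * (∫ x,
      Literature.Analysis.FluidPDE.frobeniusNormSq (fderiv ℝ (Literature.Analysis.FluidPDE.curl w) x)) ^ (3 / 4 :
      ℝ)) → c ≤ c') → ∀ ν : ℝ, 0 < ν → ∀ m : EuclideanSpace ℝ (Fin 3) → EuclideanSpace ℝ (Fin 3), ¬ ((ContDiff ℝ
      (⊤ : ℕ∞) m ∧ Literature.Analysis.FluidPDE.VectorCalculus.IsDivFree m ∧ (∫⁻ x, ‖iteratedFDeriv ℝ 0 m x‖ₑ ^ 2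
      < ⊤) ∧ (∫⁻ x, ‖iteratedFDeriv ℝ 1 m x‖ₑ ^ 2 < ⊤) ∧ (∫⁻ x, ‖iteratedFDeriv ℝ 2 m x‖ₑ ^ 2 < ⊤)) ∧ 0 < (∫ x,
      ‖Literature.Analysis.FluidPDE.curl m x‖ ^ 2) ∧ (∫ x, ⟪Literature.Analysis.FluidPDE.curl m x, fderiv ℝ m x
      (Literature.Analysis.FluidPDE.curl m x)⟫_ℝ) = c * (∫ x, ‖Literature.Analysis.FluidPDE.curl m x‖ ^ 2) ^ (3 /
      4 : ℝ) * (∫ x, Literature.Analysis.FluidPDE.frobeniusNormSq (fderiv ℝ (Literature.Analysis.FluidPDE.curl m)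
      x)) ^ (3 / 4 : ℝ) ∧ (∫ x, Literature.Analysis.FluidPDE.frobeniusNormSq (fderiv ℝ
      (Literature.Analysis.FluidPDE.curl m) x)) = 81 * c ^ 4 / (256 * ν ^ 4) * (∫ x,
      ‖Literature.Analysis.FluidPDE.curl m x‖ ^ 2) ^ 3)) :
    Summit.NavierStokesRegularity.NavierStokesRegularity.Theses.EfficiencyFloor.RigidExit :=
  fun _ => nearMaximiserBoundedAmplification_of_not_attained h

/-! ## `NearSaturationNearMaximiser` forces attainment -/

/-- **stmt-25482 ⟹ the sharp constant is attained.** If `NearSaturationNearMaximiser` holds then for the sharp one-sided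
Lu–Doering constant `c⋆` there are a viscosity `ν > 0` and a normalised maximiser (route clause verbatim). Construction: by
minimality of `c⋆`, `(1 − δ/4)·c⋆` is not admissible, so some admissible `w` has `S(w) > (1 − δ/4)·c⋆·Z^{3/4}·Pal^{3/4}`
(hence `Z, Pal > 0`); at `ν = (81c⋆⁴Z³/(256·Pal))^{1/4}` the field `w` has the Young-optimal ratio `Pal = (81c⋆⁴/(256ν⁴))Z³`,
so `2S − 2ν·Pal ≥ (1 − δ)·(27c⋆⁴/(128ν³))·Z³`, and the item (with `ε = 1`) returns a normalised maximiser near `w`.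
[folklore] -/
theorem attained_of_nearSaturationNearMaximiser
    (hN : Summit.NavierStokesRegularity.NavierStokesRegularity.Theses.EfficiencyFloor.NearSaturationNearMaximiser) :
    ∀ c : ℝ, (0 < c ∧ (∀ v : EuclideanSpace ℝ (Fin 3) → EuclideanSpace ℝ (Fin 3), (ContDiff ℝ (⊤ : ℕ∞) v ∧
      Literature.Analysis.FluidPDE.VectorCalculus.IsDivFree v ∧ (∫⁻ x, ‖iteratedFDeriv ℝ 0 v x‖ₑ ^ 2 < ⊤) ∧ (∫⁻ x,
      ‖iteratedFDeriv ℝ 1 v x‖ₑ ^ 2 < ⊤) ∧ (∫⁻ x, ‖iteratedFDeriv ℝ 2 v x‖ₑ ^ 2 < ⊤)) → (∫ x,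
      ⟪Literature.Analysis.FluidPDE.curl v x, fderiv ℝ v x (Literature.Analysis.FluidPDE.curl v x)⟫_ℝ) ≤ c * (∫ x,
      ‖Literature.Analysis.FluidPDE.curl v x‖ ^ 2) ^ (3 / 4 : ℝ) * (∫ x,
      Literature.Analysis.FluidPDE.frobeniusNormSq (fderiv ℝ (Literature.Analysis.FluidPDE.curl v) x)) ^ (3 / 4 :
      ℝ)) ∧ ∀ c' : ℝ, (∀ w : EuclideanSpace ℝ (Fin 3) → EuclideanSpace ℝ (Fin 3), (ContDiff ℝ (⊤ : ℕ∞) w ∧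
      Literature.Analysis.FluidPDE.VectorCalculus.IsDivFree w ∧ (∫⁻ x, ‖iteratedFDeriv ℝ 0 w x‖ₑ ^ 2 < ⊤) ∧ (∫⁻ x,
      ‖iteratedFDeriv ℝ 1 w x‖ₑ ^ 2 < ⊤) ∧ (∫⁻ x, ‖iteratedFDeriv ℝ 2 w x‖ₑ ^ 2 < ⊤)) → (∫ x,
      ⟪Literature.Analysis.FluidPDE.curl w x, fderiv ℝ w x (Literature.Analysis.FluidPDE.curl w x)⟫_ℝ) ≤ c' * (∫
      x, ‖Literature.Analysis.FluidPDE.curl w x‖ ^ 2) ^ (3 / 4 : ℝ) * (∫ x,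
      Literature.Analysis.FluidPDE.frobeniusNormSq (fderiv ℝ (Literature.Analysis.FluidPDE.curl w) x)) ^ (3 / 4 :
      ℝ)) → c ≤ c') → ∃ ν : ℝ, 0 < ν ∧ ∃ m : EuclideanSpace ℝ (Fin 3) → EuclideanSpace ℝ (Fin 3), ((ContDiff ℝ (⊤
      : ℕ∞) m ∧ Literature.Analysis.FluidPDE.VectorCalculus.IsDivFree m ∧ (∫⁻ x, ‖iteratedFDeriv ℝ 0 m x‖ₑ ^ 2 <
      ⊤) ∧ (∫⁻ x, ‖iteratedFDeriv ℝ 1 m x‖ₑ ^ 2 < ⊤) ∧ (∫⁻ x, ‖iteratedFDeriv ℝ 2 m x‖ₑ ^ 2 < ⊤)) ∧ 0 < (∫ x,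
      ‖Literature.Analysis.FluidPDE.curl m x‖ ^ 2) ∧ (∫ x, ⟪Literature.Analysis.FluidPDE.curl m x, fderiv ℝ m x
      (Literature.Analysis.FluidPDE.curl m x)⟫_ℝ) = c * (∫ x, ‖Literature.Analysis.FluidPDE.curl m x‖ ^ 2) ^ (3 /
      4 : ℝ) * (∫ x, Literature.Analysis.FluidPDE.frobeniusNormSq (fderiv ℝ (Literature.Analysis.FluidPDE.curl m)
      x)) ^ (3 / 4 : ℝ) ∧ (∫ x, Literature.Analysis.FluidPDE.frobeniusNormSq (fderiv ℝ
      (Literature.Analysis.FluidPDE.curl m) x)) = 81 * c ^ 4 / (256 * ν ^ 4) * (∫ x,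
      ‖Literature.Analysis.FluidPDE.curl m x‖ ^ 2) ^ 3) := by
  intro c hsharp
  have hc : 0 < c := hsharp.1
  have hadm := hsharp.2.1
  have hmin := hsharp.2.2
  obtain ⟨δ, hδ, hδlaw⟩ := hN c 1 hsharp one_pos
  -- `(1 - δ/4)·c` is not admissible
  have hc' := mt (hmin ((1 - δ / 4) * c)) (by nlinarith)
  push Not at hc'
  obtain ⟨w, hw, hSw⟩ := hc'
  set Zw : ℝ := ∫ x, ‖curl w x‖ ^ 2 with hZw
  set Pw : ℝ := ∫ x, frobeniusNormSq (fderiv ℝ (curl w) x) with hPw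
  set Sw : ℝ := ∫ x, ⟪curl w x, fderiv ℝ w x (curl w x)⟫_ℝ with hSw_def
  have hSle : Sw ≤ c * Zw ^ (3 / 4 : ℝ) * Pw ^ (3 / 4 : ℝ) := hadm w hw
  have hZ0 : 0 ≤ Zw := integral_nonneg fun x => by positivity
  have hP0 : 0 ≤ Pw := integral_nonneg fun x => frobeniusNormSq_nonneg _
  have f3 : (1 - δ / 4) * (c * Zw ^ (3 / 4 : ℝ) * Pw ^ (3 / 4 : ℝ)) < Sw := by
    calc (1 - δ / 4) * (c * Zw ^ (3 / 4 : ℝ) * Pw ^ (3 / 4 : ℝ))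
        = (1 - δ / 4) * c * Zw ^ (3 / 4 : ℝ) * Pw ^ (3 / 4 : ℝ) := by ring
      _ < Sw := hSw
  have hS0pos : 0 < c * Zw ^ (3 / 4 : ℝ) * Pw ^ (3 / 4 : ℝ) := by nlinarith
  have hZpos : 0 < Zw := by
    rcases hZ0.eq_or_lt with h0 | h0
    · exfalso
      rw [← h0, Real.zero_rpow (by norm_num), mul_zero, zero_mul] at hS0pos
      exact lt_irrefl _ hS0pos
    · exact h0
  have hPpos : 0 < Pw := by
    rcases hP0.eq_or_lt with h0 | h0
    · exfalso
      rw [← h0, Real.zero_rpow (by norm_num), mul_zero] at hS0pos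
      exact lt_irrefl _ hS0pos
    · exact h0
  -- the viscosity that makes `w`'s amplitude Young-optimal
  set x : ℝ := 81 * c ^ 4 * Zw ^ 3 / (256 * Pw) with hx
  have hxpos : 0 < x := by positivity
  set ν : ℝ := x ^ (1 / 4 : ℝ) with hνdef
  have hν : 0 < ν := Real.rpow_pos_of_pos hxpos _
  have hν4 : ν ^ 4 = x := by
    rw [hνdef, ← Real.rpow_mul_natCast hxpos.le]
    norm_num
  have hPeq : Pw = 81 * c ^ 4 / (256 * ν ^ 4) * Zw ^ 3 := by
    rw [hν4, hx]
    field_simp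
  -- at the Young-optimal amplitude the envelope value is `2K·Z³` and `2ν·Pal = 3K·Z³`
  have hsat0 := RigidExit.saturated_of_normalised (S := c * Zw ^ (3 / 4 : ℝ) * Pw ^ (3 / 4 : ℝ)) hν hc.le hZ0 rfl hPeq
  have h2νP : 2 * ν * Pw = 3 * (27 * c ^ 4 / (128 * ν ^ 3) * Zw ^ 3) := by
    rw [hPeq]
    field_simp
    ring
  have hS0eq : c * Zw ^ (3 / 4 : ℝ) * Pw ^ (3 / 4 : ℝ) = 2 * (27 * c ^ 4 / (128 * ν ^ 3) * Zw ^ 3) := by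
    linarith
  rw [hS0eq] at f3
  have hsat : (1 - δ) * (27 * c ^ 4 / (128 * ν ^ 3)) * Zw ^ 3 ≤ 2 * Sw - 2 * ν * Pw := by
    nlinarith [f3, h2νP]
  obtain ⟨m, hm, -⟩ := hδlaw ν hν w hw hZpos hsat
  exact ⟨ν, hν, m, hm⟩

/-- **Non-attainment REFUTES stmt-25482.** If for the sharp constant no normalised maximiser exists at any viscosity, then
`NearSaturationNearMaximiser` is false (the sharp constant exists: `SharpLuDoeringBudget`, stmt-25481). [folklore] -/
theorem not_nearSaturationNearMaximiser_of_not_attained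
    (h : ∀ c : ℝ, (0 < c ∧ (∀ v : EuclideanSpace ℝ (Fin 3) → EuclideanSpace ℝ (Fin 3), (ContDiff ℝ (⊤ : ℕ∞) v ∧
      Literature.Analysis.FluidPDE.VectorCalculus.IsDivFree v ∧ (∫⁻ x, ‖iteratedFDeriv ℝ 0 v x‖ₑ ^ 2 < ⊤) ∧ (∫⁻ x,
      ‖iteratedFDeriv ℝ 1 v x‖ₑ ^ 2 < ⊤) ∧ (∫⁻ x, ‖iteratedFDeriv ℝ 2 v x‖ₑ ^ 2 < ⊤)) → (∫ x,
      ⟪Literature.Analysis.FluidPDE.curl v x, fderiv ℝ v x (Literature.Analysis.FluidPDE.curl v x)⟫_ℝ) ≤ c * (∫ x,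
      ‖Literature.Analysis.FluidPDE.curl v x‖ ^ 2) ^ (3 / 4 : ℝ) * (∫ x,
      Literature.Analysis.FluidPDE.frobeniusNormSq (fderiv ℝ (Literature.Analysis.FluidPDE.curl v) x)) ^ (3 / 4 :
      ℝ)) ∧ ∀ c' : ℝ, (∀ w : EuclideanSpace ℝ (Fin 3) → EuclideanSpace ℝ (Fin 3), (ContDiff ℝ (⊤ : ℕ∞) w ∧
      Literature.Analysis.FluidPDE.VectorCalculus.IsDivFree w ∧ (∫⁻ x, ‖iteratedFDeriv ℝ 0 w x‖ₑ ^ 2 < ⊤) ∧ (∫⁻ x,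
      ‖iteratedFDeriv ℝ 1 w x‖ₑ ^ 2 < ⊤) ∧ (∫⁻ x, ‖iteratedFDeriv ℝ 2 w x‖ₑ ^ 2 < ⊤)) → (∫ x,
      ⟪Literature.Analysis.FluidPDE.curl w x, fderiv ℝ w x (Literature.Analysis.FluidPDE.curl w x)⟫_ℝ) ≤ c' * (∫
      x, ‖Literature.Analysis.FluidPDE.curl w x‖ ^ 2) ^ (3 / 4 : ℝ) * (∫ x,
      Literature.Analysis.FluidPDE.frobeniusNormSq (fderiv ℝ (Literature.Analysis.FluidPDE.curl w) x)) ^ (3 / 4 :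
      ℝ)) → c ≤ c') → ∀ ν : ℝ, 0 < ν → ∀ m : EuclideanSpace ℝ (Fin 3) → EuclideanSpace ℝ (Fin 3), ¬ ((ContDiff ℝ
      (⊤ : ℕ∞) m ∧ Literature.Analysis.FluidPDE.VectorCalculus.IsDivFree m ∧ (∫⁻ x, ‖iteratedFDeriv ℝ 0 m x‖ₑ ^ 2
      < ⊤) ∧ (∫⁻ x, ‖iteratedFDeriv ℝ 1 m x‖ₑ ^ 2 < ⊤) ∧ (∫⁻ x, ‖iteratedFDeriv ℝ 2 m x‖ₑ ^ 2 < ⊤)) ∧ 0 < (∫ x,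
      ‖Literature.Analysis.FluidPDE.curl m x‖ ^ 2) ∧ (∫ x, ⟪Literature.Analysis.FluidPDE.curl m x, fderiv ℝ m x
      (Literature.Analysis.FluidPDE.curl m x)⟫_ℝ) = c * (∫ x, ‖Literature.Analysis.FluidPDE.curl m x‖ ^ 2) ^ (3 /
      4 : ℝ) * (∫ x, Literature.Analysis.FluidPDE.frobeniusNormSq (fderiv ℝ (Literature.Analysis.FluidPDE.curl m)
      x)) ^ (3 / 4 : ℝ) ∧ (∫ x, Literature.Analysis.FluidPDE.frobeniusNormSq (fderiv ℝ
      (Literature.Analysis.FluidPDE.curl m) x)) = 81 * c ^ 4 / (256 * ν ^ 4) * (∫ x,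
      ‖Literature.Analysis.FluidPDE.curl m x‖ ^ 2) ^ 3)) :
    ¬ Summit.NavierStokesRegularity.NavierStokesRegularity.Theses.EfficiencyFloor.NearSaturationNearMaximiser := by
  intro hN
  obtain ⟨c, hsharp, -⟩ := efficiencyFloor_sharpLuDoeringBudget_proof
  obtain ⟨ν, hν, m, hm⟩ := attained_of_nearSaturationNearMaximiser hN c hsharp
  exact h c hsharp ν hν m hm

/-- **The dichotomy in one line**: under NON-attainment the rung's bet nodes 25483, 25512, 25513 hold (vacuously) while its
variational node 25482 fails. [folklore] -/
theorem dichotomy_of_not_attained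
    (h : ∀ c : ℝ, (0 < c ∧ (∀ v : EuclideanSpace ℝ (Fin 3) → EuclideanSpace ℝ (Fin 3), (ContDiff ℝ (⊤ : ℕ∞) v ∧
      Literature.Analysis.FluidPDE.VectorCalculus.IsDivFree v ∧ (∫⁻ x, ‖iteratedFDeriv ℝ 0 v x‖ₑ ^ 2 < ⊤) ∧ (∫⁻ x,
      ‖iteratedFDeriv ℝ 1 v x‖ₑ ^ 2 < ⊤) ∧ (∫⁻ x, ‖iteratedFDeriv ℝ 2 v x‖ₑ ^ 2 < ⊤)) → (∫ x,
      ⟪Literature.Analysis.FluidPDE.curl v x, fderiv ℝ v x (Literature.Analysis.FluidPDE.curl v x)⟫_ℝ) ≤ c * (∫ x,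
      ‖Literature.Analysis.FluidPDE.curl v x‖ ^ 2) ^ (3 / 4 : ℝ) * (∫ x,
      Literature.Analysis.FluidPDE.frobeniusNormSq (fderiv ℝ (Literature.Analysis.FluidPDE.curl v) x)) ^ (3 / 4 :
      ℝ)) ∧ ∀ c' : ℝ, (∀ w : EuclideanSpace ℝ (Fin 3) → EuclideanSpace ℝ (Fin 3), (ContDiff ℝ (⊤ : ℕ∞) w ∧
      Literature.Analysis.FluidPDE.VectorCalculus.IsDivFree w ∧ (∫⁻ x, ‖iteratedFDeriv ℝ 0 w x‖ₑ ^ 2 < ⊤) ∧ (∫⁻ x,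
      ‖iteratedFDeriv ℝ 1 w x‖ₑ ^ 2 < ⊤) ∧ (∫⁻ x, ‖iteratedFDeriv ℝ 2 w x‖ₑ ^ 2 < ⊤)) → (∫ x,
      ⟪Literature.Analysis.FluidPDE.curl w x, fderiv ℝ w x (Literature.Analysis.FluidPDE.curl w x)⟫_ℝ) ≤ c' * (∫
      x, ‖Literature.Analysis.FluidPDE.curl w x‖ ^ 2) ^ (3 / 4 : ℝ) * (∫ x,
      Literature.Analysis.FluidPDE.frobeniusNormSq (fderiv ℝ (Literature.Analysis.FluidPDE.curl w) x)) ^ (3 / 4 :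
      ℝ)) → c ≤ c') → ∀ ν : ℝ, 0 < ν → ∀ m : EuclideanSpace ℝ (Fin 3) → EuclideanSpace ℝ (Fin 3), ¬ ((ContDiff ℝ
      (⊤ : ℕ∞) m ∧ Literature.Analysis.FluidPDE.VectorCalculus.IsDivFree m ∧ (∫⁻ x, ‖iteratedFDeriv ℝ 0 m x‖ₑ ^ 2
      < ⊤) ∧ (∫⁻ x, ‖iteratedFDeriv ℝ 1 m x‖ₑ ^ 2 < ⊤) ∧ (∫⁻ x, ‖iteratedFDeriv ℝ 2 m x‖ₑ ^ 2 < ⊤)) ∧ 0 < (∫ x,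
      ‖Literature.Analysis.FluidPDE.curl m x‖ ^ 2) ∧ (∫ x, ⟪Literature.Analysis.FluidPDE.curl m x, fderiv ℝ m x
      (Literature.Analysis.FluidPDE.curl m x)⟫_ℝ) = c * (∫ x, ‖Literature.Analysis.FluidPDE.curl m x‖ ^ 2) ^ (3 /
      4 : ℝ) * (∫ x, Literature.Analysis.FluidPDE.frobeniusNormSq (fderiv ℝ (Literature.Analysis.FluidPDE.curl m)
      x)) ^ (3 / 4 : ℝ) ∧ (∫ x, Literature.Analysis.FluidPDE.frobeniusNormSq (fderiv ℝ
      (Literature.Analysis.FluidPDE.curl m) x)) = 81 * c ^ 4 / (256 * ν ^ 4) * (∫ x,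
      ‖Literature.Analysis.FluidPDE.curl m x‖ ^ 2) ^ 3)) :
    Summit.NavierStokesRegularity.NavierStokesRegularity.Theses.EfficiencyFloor.NearMaximiserBoundedAmplification ∧ Summit.NavierStokesRegularity.NavierStokesRegularity.Theses.EfficiencyFloor.MaximiserSetRigidity ∧ Summit.NavierStokesRegularity.NavierStokesRegularity.Theses.EfficiencyFloor.RigidExit ∧
      ¬ Summit.NavierStokesRegularity.NavierStokesRegularity.Theses.EfficiencyFloor.NearSaturationNearMaximiser :=
  ⟨nearMaximiserBoundedAmplification_of_not_attained h, maximiserSetRigidity_of_not_attained h,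
    rigidExit_of_not_attained h, not_nearSaturationNearMaximiser_of_not_attained h⟩

end Attainment

end LerayFloorGap

end Summit.NavierStokesRegularity.NavierStokesRegularity.Theorems

end
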